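import Summits.ABC.ABC.Theorems.IneffectiveSubspaceUniformSadicTowerFourHeavyCollapse
import Summits.ABC.ABC.Theorems.IneffectiveSubspaceTowerFourGivesDepthCounted
import Summits.ABC.ABC.Theorems.IneffectiveSubspaceDeepRegimeABCOmegaTail

/-!
# `UniformSadicTowerFour` (stmt-ABC-14937) modulo crux #6: crux #5 slotted into the collapse (line `flat-steep-split`, lead c5)

The route's deciding theorem `closes` derives crux #5 `DepthCountedABC` (abc with a constant per depth
cell `{ω₅(abc) ≤ K}`, `ω₅(n) := #{p : p⁵ ∣ n}`) from crux #2 `UniformSadicTowerFour` by the proved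
dictionary `towerFourGivesDepthCounted_proof`, and then `ABC` from #5 and crux #6 `DeepRegimeABC` by the case
split `DeepRegimeABC.abc_of_depthCountedABC_of_deepRegimeABC`.  The collapse file
(`Theorems/IneffectiveSubspaceUniformSadicTowerFourHeavyCollapse.lean`, `HeavyPlaces.tfae_of_deepRegimeABC`) lists,
modulo #6, the equivalent rungs `[ABC, crux #2, HEAVY-CORE, level-one rung, BoundedOmegaABC]`, where
BoundedOmegaABC is abc on every bounded-`ω` cell `{ω(abc) ≤ W}` with `C(W, ε)`.  This file slots crux #5 into
that list BY NAME:

* `boundedOmega_of_depthCountedABC`: #5 ⟹ BoundedOmegaABC OUTRIGHT (no #6): on the cell `{ω(abc) ≤ W}` one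
  has `ω₅(abc) ≤ ω(abc) ≤ W` (`Finset.card_filter_le`), so the depth cell `K := W` of #5 applies verbatim;
* `uniformSadicTowerFour_iff_depthCountedABC_of_deepRegimeABC`: under #6, crux #2 ⟺ crux #5
  (`→` the dictionary; `←` #5 ∧ #6 ⟹ `ABC` ⟹ #2 by `abcGivesUniformSadic_proof`);
* `depthCountedABC_iff_abc_of_deepRegimeABC`: under #6, crux #5 ⟺ `ABC`;
* `tfae_depthCounted_of_deepRegimeABC`: under #6 the four statements `ABC`, `UniformSadicTowerFour`,
  `DepthCountedABC`, BoundedOmegaABC are pairwise equivalent.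

Reading for the planner: for THIS route (which carries #6 as a hypothesis of `closes`) the binders #2 and #5
are interchangeable with each other and with BoundedOmegaABC; nothing level-four-specific is consumed.
No new definitions.  Deliberately NOT here: any of the cruxes themselves (open, abc-type).
-/

noncomputable section

-- `Summit.<Summit>.<Problem>` is the mandated summit-side namespace (CONVENTIONS §2); for the
-- single-conjunct summit `ABC` the two coincide, so the duplicate `ABC.ABC` is deliberate.
set_option linter.dupNamespace false

namespace Summit.ABC.ABC.Theorems.UniformSadicTowerFour.HeavyPlaces

open Literature.NumberTheory.DiophantineGeometry (IsABCTriple rad)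
open Summit.ABC.ABC.Theses.IneffectiveSubspace
open Summit.ABC.ABC.Theorems.DeepRegimeABC
  (abc_of_depthCountedABC_of_deepRegimeABC abc_of_deepRegimeABC_of_boundedOmega)

/-! ## Crux #5 gives abc on bounded-`ω` cells, unconditionally -/

/-- **`DepthCountedABC ⟹ BoundedOmegaABC`** (no `DeepRegimeABC` needed): abc with a constant per depth
cell `{ω₅(abc) ≤ K}` gives abc on every bounded-`ω` cell `{ω(abc) ≤ W}` with the constant of the depth
cell `K := W`, because the deep primes of `abc` are among its primes: `ω₅(abc) ≤ ω(abc)`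
(`Finset.card_filter_le`). [folklore] -/
theorem boundedOmega_of_depthCountedABC (h₅ : DepthCountedABC) :
    ∀ W : ℕ, ∀ ε : ℝ, 0 < ε → ∃ C : ℝ, 0 < C ∧ ∀ a b c : ℕ, IsABCTriple a b c →
      (a * b * c).primeFactors.card ≤ W →
      (c : ℝ) < C * ((rad a b c : ℕ) : ℝ) ^ (1 + ε) := by
  intro W ε hε
  obtain ⟨C, hC, hW⟩ := h₅ W ε hε
  exact ⟨C, hC, fun a b c habc hcard =>
    hW a b c habc ((Finset.card_filter_le _ _).trans hcard)⟩

/-! ## Crux #5 in the collapse modulo crux #6 -/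

/-- **Modulo #6 the crux IS crux #5**: under `DeepRegimeABC`, `UniformSadicTowerFour ↔ DepthCountedABC`.
`→` is the proved dictionary `towerFourGivesDepthCounted_proof` (optimal level-4 lifts, Vojta 2000 §3.1);
`←` is the route's case split `abc_of_depthCountedABC_of_deepRegimeABC` (#5 ∧ #6 ⟹ `ABC`) followed by
`abcGivesUniformSadic_proof` (`ABC` ⟹ #2). [folklore] -/
theorem uniformSadicTowerFour_iff_depthCountedABC_of_deepRegimeABC (h₆ : DeepRegimeABC) :
    UniformSadicTowerFour ↔ DepthCountedABC :=
  ⟨(show UniformSadicTowerFour → DepthCountedABC from towerFourGivesDepthCounted_proof),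
    fun h₅ => (show ABC → UniformSadicTowerFour from abcGivesUniformSadic_proof)
      (abc_of_depthCountedABC_of_deepRegimeABC h₅ h₆)⟩

/-- **Modulo #6 crux #5 is `ABC`**: under `DeepRegimeABC`, `DepthCountedABC ↔ ABC` (`→` the case split
`abc_of_depthCountedABC_of_deepRegimeABC`; `←` `ABC` ⟹ #2 ⟹ #5 by `abcGivesUniformSadic_proof` and the
dictionary `towerFourGivesDepthCounted_proof`). [folklore] -/
theorem depthCountedABC_iff_abc_of_deepRegimeABC (h₆ : DeepRegimeABC) : DepthCountedABC ↔ ABC :=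
  ⟨fun h₅ => abc_of_depthCountedABC_of_deepRegimeABC h₅ h₆,
    fun h => (show UniformSadicTowerFour → DepthCountedABC from towerFourGivesDepthCounted_proof)
      ((show ABC → UniformSadicTowerFour from abcGivesUniformSadic_proof) h)⟩

/-- **Collapse with crux #5 slotted in.** Under crux #6 `DeepRegimeABC` the four statements `ABC`,
`UniformSadicTowerFour` (crux #2), `DepthCountedABC` (crux #5) and BoundedOmegaABC (abc on every
bounded-`ω` cell) are pairwise equivalent.  Arrows: `abcGivesUniformSadic_proof` (1 → 2), the dictionary
`towerFourGivesDepthCounted_proof` (2 → 3), `boundedOmega_of_depthCountedABC` (3 → 4, unconditional), and the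
complement theorem `abc_of_deepRegimeABC_of_boundedOmega` (4 → 1, the only arrow using #6). [folklore] -/
theorem tfae_depthCounted_of_deepRegimeABC (h₆ : DeepRegimeABC) :
    List.TFAE [
      ABC,
      UniformSadicTowerFour,
      DepthCountedABC,
      (∀ W : ℕ, ∀ ε : ℝ, 0 < ε → ∃ C : ℝ, 0 < C ∧ ∀ a b c : ℕ, IsABCTriple a b c →
        (a * b * c).primeFactors.card ≤ W →
        (c : ℝ) < C * ((rad a b c : ℕ) : ℝ) ^ (1 + ε))] := by
  tfae_have 1 → 2 := fun h => (show ABC → UniformSadicTowerFour from abcGivesUniformSadic_proof) h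
  tfae_have 2 → 3 := fun h =>
    (show UniformSadicTowerFour → DepthCountedABC from towerFourGivesDepthCounted_proof) h
  tfae_have 3 → 4 := fun h => boundedOmega_of_depthCountedABC h
  tfae_have 4 → 1 := fun h => abc_of_deepRegimeABC_of_boundedOmega h₆ h
  tfae_finish

end Summit.ABC.ABC.Theorems.UniformSadicTowerFour.HeavyPlaces

end
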